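import Mathlib

/-!
# PneNP / ConvexRankGates — `ConvexGateBlind`: exponential moments of the monochromatic mass of a random colouring

Helpers (`--supports stmt-PneNP-10680`), COLUMN-SPACE line (prover seat 2, session 13): the probabilistic core of the
catch-probability bound, in matrix form and by pure counting over the `q^m` colourings `c : Fin m → Fin q`. For a
symmetric zero-diagonal weight matrix `V` on `Fin m` (the edge weighting of the line, `V x y = v{x,y}`) put

  `M(S, c) = ½ ∑_{x,y ∈ S} V x y · 𝟙[c x = c y]`  (monochromatic mass inside `S`),  `mass(S) = ½ ∑_{x,y ∈ S} V x y`,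
  `deg x = ∑_y |V x y|`.

Exposing the vertices outside a "hub" set `H` one at a time, the increments of `M` have conditional mean
`(increment of mass)/q` and are bounded by the degrees, and the elementary inequality `e^y ≤ 1 + y + y²` (`|y| ≤ 1`)
gives the sub-Gaussian-type bound

* `expMoment_le` — `∑_c exp(λ·(M(univ,c) − M(H,c) − (mass(univ) − mass(H))/q)) ≤ q^m · exp(4λ² ∑_{x ∉ H} deg(x)²)`
  whenever `0 ≤ λ`, `2λ·deg(x) ≤ 1` off `H` (stub `monoMass_expMoment`);
* `card_filter_le_mul_exp` — Markov: `#{c : t ≤ T c} ≤ e^{−λt} · ∑_c e^{λ T c}`.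

Ingredients: `sum_eq_sum_sum_update_div` (re-randomising one coordinate: `∑_c F(c) = q⁻¹ ∑_c ∑_i F(c[x ↦ i])`, via
the involution `(c,i) ↦ (c[x ↦ i], c x)`), `sum_exp_le_of_sum_eq_zero` (one step). [new; elementary — a discrete
Azuma/Bernstein inequality for the vertex-exposure martingale, no measure theory]
-/

set_option linter.dupNamespace false

namespace Summit.PneNP.PneNP.Theorems

open Finset Real

noncomputable section

/-! ## Two elementary lemmas -/

/-- **Re-randomising one coordinate.** For `0 < q` and any `F`: `∑_c F(c) = (∑_c ∑_i F(c[x ↦ i])) / q`.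
(The map `(c, i) ↦ (c[x ↦ i], c x)` is an involution of `(Fin m → Fin q) × Fin q`.) [folklore] -/
theorem sum_eq_sum_sum_update_div {m q : ℕ} (hq : 0 < q) (F : (Fin m → Fin q) → ℝ) (x : Fin m) :
    ∑ c : Fin m → Fin q, F c = (∑ c : Fin m → Fin q, ∑ i : Fin q, F (Function.update c x i)) / q := by
  classical
  have hq' : (q : ℝ) ≠ 0 := by exact_mod_cast hq.ne'
  rw [eq_div_iff hq']
  set Φ : (Fin m → Fin q) × Fin q → (Fin m → Fin q) × Fin q := fun p => (Function.update p.1 x p.2, p.1 x) with hΦ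
  have hinv : Function.Involutive Φ := by
    rintro ⟨c, i⟩
    simp only [hΦ, Function.update_idem, Function.update_self, Function.update_eq_self]
  calc (∑ c : Fin m → Fin q, F c) * q = ∑ c : Fin m → Fin q, ∑ _i : Fin q, F c := by
        rw [Finset.sum_mul]
        refine Finset.sum_congr rfl fun c _ => ?_
        rw [Finset.sum_const, Finset.card_univ, Fintype.card_fin, nsmul_eq_mul, mul_comm]
    _ = ∑ p : (Fin m → Fin q) × Fin q, F p.1 :=
        (Fintype.sum_prod_type (fun p : (Fin m → Fin q) × Fin q => F p.1)).symm
    _ = ∑ p : (Fin m → Fin q) × Fin q, F (Φ p).1 := (Function.Bijective.sum_comp hinv.bijective (fun p => F p.1)).symm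
    _ = ∑ c : Fin m → Fin q, ∑ i : Fin q, F (Function.update c x i) :=
        Fintype.sum_prod_type (fun p : (Fin m → Fin q) × Fin q => F (Φ p).1)

/-- **One step.** If `∑_i y_i = 0` and `|y_i| ≤ a ≤ 1` then `∑_i e^{y_i} ≤ q · e^{a²}` (from `e^y ≤ 1 + y + y²` on
`[-1, 1]`). [folklore] -/
theorem sum_exp_le_of_sum_eq_zero {q : ℕ} (y : Fin q → ℝ) {a : ℝ} (ha : a ≤ 1) (hy : ∀ i, |y i| ≤ a)
    (h0 : ∑ i, y i = 0) : ∑ i, Real.exp (y i) ≤ q * Real.exp (a ^ 2) := by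
  have hpt : ∀ i, Real.exp (y i) ≤ 1 + y i + a ^ 2 := by
    intro i
    have h1 : |y i| ≤ 1 := (hy i).trans ha
    have h2 := Real.abs_exp_sub_one_sub_id_le h1
    have h3 : (y i) ^ 2 ≤ a ^ 2 := by
      rw [← sq_abs]
      exact pow_le_pow_left₀ (abs_nonneg _) (hy i) 2
    have h4 := (abs_le.1 h2).2
    linarith
  calc ∑ i, Real.exp (y i) ≤ ∑ i, (1 + y i + a ^ 2) := Finset.sum_le_sum fun i _ => hpt i
    _ = q * (1 + a ^ 2) := by
        rw [Finset.sum_add_distrib, Finset.sum_add_distrib, h0, Finset.sum_const, Finset.sum_const, Finset.card_univ,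
          Fintype.card_fin, nsmul_eq_mul, nsmul_eq_mul]
        ring
    _ ≤ q * Real.exp (a ^ 2) := by
        gcongr
        linarith [Real.add_one_le_exp (a ^ 2)]

/-- **Markov for exponential moments.** `#{a : t ≤ T a} ≤ e^{−λt} ∑_a e^{λ T a}` for `λ ≥ 0`. [folklore] -/
theorem card_filter_le_mul_exp {α : Type} [Fintype α] (T : α → ℝ) {lam : ℝ} (hlam : 0 ≤ lam) (t : ℝ) :
    (((Finset.univ : Finset α).filter (fun a => t ≤ T a)).card : ℝ) ≤
      Real.exp (-(lam * t)) * ∑ a, Real.exp (lam * T a) := by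
  classical
  rw [Real.exp_neg, ← div_eq_inv_mul, le_div_iff₀ (Real.exp_pos _)]
  calc (((Finset.univ : Finset α).filter (fun a => t ≤ T a)).card : ℝ) * Real.exp (lam * t)
      = ∑ _a ∈ (Finset.univ : Finset α).filter (fun a => t ≤ T a), Real.exp (lam * t) := by
        rw [Finset.sum_const, nsmul_eq_mul]
    _ ≤ ∑ a ∈ (Finset.univ : Finset α).filter (fun a => t ≤ T a), Real.exp (lam * T a) := by
        refine Finset.sum_le_sum fun a ha => ?_
        exact Real.exp_le_exp.2 (mul_le_mul_of_nonneg_left (Finset.mem_filter.1 ha).2 hlam)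
    _ ≤ ∑ a, Real.exp (lam * T a) :=
        Finset.sum_le_sum_of_subset_of_nonneg (Finset.filter_subset _ _) fun a _ _ => (Real.exp_pos _).le

/-! ## Peeling one vertex -/

variable {m q : ℕ}

/-- Peeling a vertex `x ∉ S` off a double sum over `insert x S`. [folklore] -/
theorem sum_sum_insert_eq (G : Fin m → Fin m → ℝ) {S : Finset (Fin m)} {x : Fin m} (hx : x ∉ S) :
    ∑ a ∈ insert x S, ∑ b ∈ insert x S, G a b =
      (∑ a ∈ S, ∑ b ∈ S, G a b) + ∑ u ∈ S, (G u x + G x u) + G x x := by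
  classical
  rw [Finset.sum_insert hx, Finset.sum_insert hx]
  have h : ∀ a ∈ S, ∑ b ∈ insert x S, G a b = G a x + ∑ b ∈ S, G a b := fun a _ => Finset.sum_insert hx
  rw [Finset.sum_congr rfl h, Finset.sum_add_distrib, Finset.sum_add_distrib]
  ring

/-- The monochromatic mass inside `insert x S` exceeds the one inside `S` by the mass of the edges from `x` into its
own colour class within `S` (`V` symmetric with zero diagonal). [folklore] -/
theorem monoMass_insert (V : Fin m → Fin m → ℝ) (hV : ∀ x y, V x y = V y x) (hV0 : ∀ x, V x x = 0)
    (c : Fin m → Fin q) {S : Finset (Fin m)} {x : Fin m} (hx : x ∉ S) :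
    (∑ a ∈ insert x S, ∑ b ∈ insert x S, if c a = c b then V a b else 0) / 2 =
      (∑ a ∈ S, ∑ b ∈ S, if c a = c b then V a b else 0) / 2 + ∑ u ∈ S, (if c u = c x then V u x else 0) := by
  rw [sum_sum_insert_eq _ hx, if_pos rfl, hV0, add_zero]
  have h : ∀ u ∈ S, ((if c u = c x then V u x else 0) + (if c x = c u then V x u else 0)) =
      2 * (if c u = c x then V u x else 0) := by
    intro u _
    by_cases hcu : c u = c x
    · rw [if_pos hcu, if_pos hcu.symm, hV x u]; ring
    · rw [if_neg hcu, if_neg (fun h => hcu h.symm)]; ring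
  rw [Finset.sum_congr rfl h, ← Finset.mul_sum]
  ring

/-- The total mass inside `insert x S` (`V` symmetric, zero diagonal). [folklore] -/
theorem mass_insert (V : Fin m → Fin m → ℝ) (hV : ∀ x y, V x y = V y x) (hV0 : ∀ x, V x x = 0)
    {S : Finset (Fin m)} {x : Fin m} (hx : x ∉ S) :
    (∑ a ∈ insert x S, ∑ b ∈ insert x S, V a b) / 2 = (∑ a ∈ S, ∑ b ∈ S, V a b) / 2 + ∑ u ∈ S, V u x := by
  rw [sum_sum_insert_eq _ hx, hV0, add_zero]
  have h : ∀ u ∈ S, V u x + V x u = 2 * V u x := fun u _ => by rw [hV x u]; ring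
  rw [Finset.sum_congr rfl h, ← Finset.mul_sum]
  ring

/-- Recolouring a vertex outside `S` does not change the monochromatic mass inside `S`. [folklore] -/
theorem monoMass_update_of_notMem (V : Fin m → Fin m → ℝ) (c : Fin m → Fin q) {S : Finset (Fin m)} {x : Fin m}
    (hx : x ∉ S) (i : Fin q) :
    (∑ a ∈ S, ∑ b ∈ S, if Function.update c x i a = Function.update c x i b then V a b else 0) =
      ∑ a ∈ S, ∑ b ∈ S, if c a = c b then V a b else 0 := by
  refine Finset.sum_congr rfl fun a ha => Finset.sum_congr rfl fun b hb => ?_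
  rw [Function.update_of_ne (ne_of_mem_of_not_mem ha hx), Function.update_of_ne (ne_of_mem_of_not_mem hb hx)]

/-- **The one-vertex averaging step.** For `x ∉ S`, `0 < q`, `0 ≤ λ` and `2λ·deg(x) ≤ 1`:
`∑_i exp(λ(∑_{u ∈ S} V u x 𝟙[c u = i] − (∑_{u ∈ S} V u x)/q)) ≤ q · exp(4 λ² deg(x)²)`. [new; elementary] -/
theorem sum_exp_step_le (V : Fin m → Fin m → ℝ) (hV : ∀ x y, V x y = V y x) (hq : 0 < q) (c : Fin m → Fin q)
    {S : Finset (Fin m)} {x : Fin m} {lam : ℝ} (hlam : 0 ≤ lam) (hdeg : 2 * lam * ∑ y, |V x y| ≤ 1) :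
    ∑ i : Fin q, Real.exp (lam * ((∑ u ∈ S, if c u = i then V u x else 0) - (∑ u ∈ S, V u x) / q)) ≤
      q * Real.exp (4 * lam ^ 2 * (∑ y, |V x y|) ^ 2) := by
  classical
  have hq' : (q : ℝ) ≠ 0 := by exact_mod_cast hq.ne'
  have hq1 : (1 : ℝ) ≤ q := by exact_mod_cast hq
  set D : ℝ := ∑ y, |V x y| with hD
  have hD0 : 0 ≤ D := Finset.sum_nonneg fun y _ => abs_nonneg _
  -- the column sums into `S` are bounded by the degree
  have hS : ∑ u ∈ S, |V u x| ≤ D := by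
    calc ∑ u ∈ S, |V u x| = ∑ u ∈ S, |V x u| := Finset.sum_congr rfl fun u _ => by rw [hV u x]
      _ ≤ ∑ u, |V x u| := Finset.sum_le_sum_of_subset_of_nonneg (Finset.subset_univ _) fun u _ _ => abs_nonneg _
  have hA : ∀ i : Fin q, |∑ u ∈ S, (if c u = i then V u x else 0)| ≤ D := by
    intro i
    refine (Finset.abs_sum_le_sum_abs _ _).trans (le_trans (Finset.sum_le_sum fun u _ => ?_) hS)
    by_cases h : c u = i
    · rw [if_pos h]
    · rw [if_neg h, abs_zero]; exact abs_nonneg _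
  have hμ : |(∑ u ∈ S, V u x) / q| ≤ D := by
    rw [abs_div, abs_of_pos (by exact_mod_cast hq : (0 : ℝ) < q)]
    calc |∑ u ∈ S, V u x| / q ≤ |∑ u ∈ S, V u x| / 1 := by
          exact div_le_div_of_nonneg_left (abs_nonneg _) one_pos hq1
      _ ≤ D := by rw [div_one]; exact (Finset.abs_sum_le_sum_abs _ _).trans hS
  have key := sum_exp_le_of_sum_eq_zero
    (fun i : Fin q => lam * ((∑ u ∈ S, if c u = i then V u x else 0) - (∑ u ∈ S, V u x) / q))
    (a := 2 * lam * D) (by linarith) ?_ ?_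
  · calc _ ≤ (q : ℝ) * Real.exp ((2 * lam * D) ^ 2) := key
      _ = q * Real.exp (4 * lam ^ 2 * D ^ 2) := by ring_nf
  · intro i
    rw [abs_mul, abs_of_nonneg hlam]
    calc lam * |(∑ u ∈ S, if c u = i then V u x else 0) - (∑ u ∈ S, V u x) / q|
        ≤ lam * (D + D) := by
          refine mul_le_mul_of_nonneg_left ((abs_sub _ _).trans (add_le_add (hA i) hμ)) hlam
      _ = 2 * lam * D := by ring
  · -- the increments have mean zero
    rw [← Finset.mul_sum, Finset.sum_sub_distrib, Finset.sum_comm]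
    have h1 : ∀ u ∈ S, ∑ i : Fin q, (if c u = i then V u x else 0) = V u x := fun u _ => by
      rw [Finset.sum_ite_eq, if_pos (Finset.mem_univ _)]
    rw [Finset.sum_congr rfl h1, Finset.sum_const, Finset.card_univ, Fintype.card_fin, nsmul_eq_mul,
      mul_div_cancel₀ _ hq', sub_self, mul_zero]

/-! ## The exponential moment bound -/

/-- **Exponential moment of the monochromatic mass (induction over the exposed set).** For `V` symmetric with zero
diagonal, `0 < q`, `0 ≤ λ`, a vertex set `H` and `2λ·deg(x) ≤ 1` for all `x ∉ H`: for every `s` disjoint from `H`,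
`∑_c exp(λ·(M(H ∪ s, c) − M(H, c) − (mass(H ∪ s) − mass H)/q)) ≤ q^m · exp(4λ² ∑_{x ∈ s} deg(x)²)`. [new] -/
theorem expMoment_induction (V : Fin m → Fin m → ℝ) (hV : ∀ x y, V x y = V y x) (hV0 : ∀ x, V x x = 0)
    (hq : 0 < q) (H : Finset (Fin m)) {lam : ℝ} (hlam : 0 ≤ lam) (hdeg : ∀ x, x ∉ H → 2 * lam * ∑ y, |V x y| ≤ 1) :
    ∀ s : Finset (Fin m), Disjoint s H →
      ∑ c : Fin m → Fin q, Real.exp (lam *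
          ((∑ a ∈ H ∪ s, ∑ b ∈ H ∪ s, if c a = c b then V a b else 0) / 2 -
            (∑ a ∈ H, ∑ b ∈ H, if c a = c b then V a b else 0) / 2 -
            ((∑ a ∈ H ∪ s, ∑ b ∈ H ∪ s, V a b) / 2 - (∑ a ∈ H, ∑ b ∈ H, V a b) / 2) / q)) ≤
        (q : ℝ) ^ m * Real.exp (4 * lam ^ 2 * ∑ x ∈ s, (∑ y, |V x y|) ^ 2) := by
  classical
  intro s
  induction s using Finset.induction_on with
  | empty =>
    intro _
    simp only [Finset.union_empty, sub_self, zero_div, mul_zero, Real.exp_zero, Finset.sum_const, Finset.card_univ,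
      Finset.sum_empty, mul_one, nsmul_eq_mul]
    rw [Fintype.card_fun, Fintype.card_fin, Fintype.card_fin]
    push_cast
    exact le_rfl
  | @insert x s hxs ih =>
    intro hdisj
    have hxH : x ∉ H := Finset.disjoint_left.1 hdisj (Finset.mem_insert_self x s)
    have hdisj' : Disjoint s H := Finset.disjoint_of_subset_left (Finset.subset_insert x s) hdisj
    have hx : x ∉ H ∪ s := by
      rw [Finset.mem_union, not_or]; exact ⟨hxH, hxs⟩
    have hHs : H ∪ insert x s = insert x (H ∪ s) := by
      rw [Finset.union_insert]
    rw [hHs]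
    -- peel `x`
    have hM : ∀ c : Fin m → Fin q,
        (∑ a ∈ insert x (H ∪ s), ∑ b ∈ insert x (H ∪ s), if c a = c b then V a b else 0) / 2 =
          (∑ a ∈ H ∪ s, ∑ b ∈ H ∪ s, if c a = c b then V a b else 0) / 2 +
            ∑ u ∈ H ∪ s, (if c u = c x then V u x else 0) := fun c => monoMass_insert V hV hV0 c hx
    have hm := mass_insert V hV hV0 hx (S := H ∪ s)
    simp_rw [hM]
    rw [hm]
    -- rewrite the exponent as `old c + new c`
    set old : (Fin m → Fin q) → ℝ := fun c => lam *
        ((∑ a ∈ H ∪ s, ∑ b ∈ H ∪ s, if c a = c b then V a b else 0) / 2 -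
          (∑ a ∈ H, ∑ b ∈ H, if c a = c b then V a b else 0) / 2 -
          ((∑ a ∈ H ∪ s, ∑ b ∈ H ∪ s, V a b) / 2 - (∑ a ∈ H, ∑ b ∈ H, V a b) / 2) / q) with hold
    set new : (Fin m → Fin q) → ℝ := fun c => lam *
        ((∑ u ∈ H ∪ s, if c u = c x then V u x else 0) - (∑ u ∈ H ∪ s, V u x) / q) with hnew
    have hsplit : ∀ c : Fin m → Fin q, Real.exp (lam *
        ((∑ a ∈ H ∪ s, ∑ b ∈ H ∪ s, if c a = c b then V a b else 0) / 2 +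
              ∑ u ∈ H ∪ s, (if c u = c x then V u x else 0) -
            (∑ a ∈ H, ∑ b ∈ H, if c a = c b then V a b else 0) / 2 -
            ((∑ a ∈ H ∪ s, ∑ b ∈ H ∪ s, V a b) / 2 + ∑ u ∈ H ∪ s, V u x -
              (∑ a ∈ H, ∑ b ∈ H, V a b) / 2) / q)) = Real.exp (old c) * Real.exp (new c) := by
      intro c
      rw [← Real.exp_add]
      congr 1
      simp only [hold, hnew]
      ring
    simp_rw [hsplit]
    -- re-randomise the colour of `x`
    rw [sum_eq_sum_sum_update_div hq (fun c => Real.exp (old c) * Real.exp (new c)) x]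
    have hold_upd : ∀ (c : Fin m → Fin q) (i : Fin q), old (Function.update c x i) = old c := by
      intro c i
      simp only [hold]
      rw [monoMass_update_of_notMem V c hx, monoMass_update_of_notMem V c hxH]
    have hnew_upd : ∀ (c : Fin m → Fin q) (i : Fin q), new (Function.update c x i) =
        lam * ((∑ u ∈ H ∪ s, if c u = i then V u x else 0) - (∑ u ∈ H ∪ s, V u x) / q) := by
      intro c i
      simp only [hnew, Function.update_self]
      congr 1
      congr 1
      refine Finset.sum_congr rfl fun u hu => ?_
      rw [Function.update_of_ne (ne_of_mem_of_not_mem hu hx)]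
    simp_rw [hold_upd, hnew_upd, ← Finset.mul_sum]
    -- the one-vertex step
    have hstep : ∀ c : Fin m → Fin q,
        Real.exp (old c) * ∑ i : Fin q, Real.exp (lam * ((∑ u ∈ H ∪ s, if c u = i then V u x else 0) -
            (∑ u ∈ H ∪ s, V u x) / q)) ≤
          Real.exp (old c) * (q * Real.exp (4 * lam ^ 2 * (∑ y, |V x y|) ^ 2)) := fun c =>
      mul_le_mul_of_nonneg_left (sum_exp_step_le V hV hq c hlam (hdeg x hxH)) (Real.exp_pos _).le
    have hq' : (0 : ℝ) < q := by exact_mod_cast hq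
    calc (∑ c : Fin m → Fin q, Real.exp (old c) *
            ∑ i : Fin q, Real.exp (lam * ((∑ u ∈ H ∪ s, if c u = i then V u x else 0) -
              (∑ u ∈ H ∪ s, V u x) / q))) / q
        ≤ (∑ c : Fin m → Fin q, Real.exp (old c) * (q * Real.exp (4 * lam ^ 2 * (∑ y, |V x y|) ^ 2))) / q :=
          div_le_div_of_nonneg_right (Finset.sum_le_sum fun c _ => hstep c) hq'.le
      _ = Real.exp (4 * lam ^ 2 * (∑ y, |V x y|) ^ 2) * ∑ c : Fin m → Fin q, Real.exp (old c) := by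
          rw [← Finset.sum_mul]
          field_simp
      _ ≤ Real.exp (4 * lam ^ 2 * (∑ y, |V x y|) ^ 2) *
            ((q : ℝ) ^ m * Real.exp (4 * lam ^ 2 * ∑ x ∈ s, (∑ y, |V x y|) ^ 2)) :=
          mul_le_mul_of_nonneg_left (ih hdisj') (Real.exp_pos _).le
      _ = (q : ℝ) ^ m * Real.exp (4 * lam ^ 2 * ∑ x ∈ insert x s, (∑ y, |V x y|) ^ 2) := by
          rw [Finset.sum_insert hxs, mul_add, Real.exp_add]
          ring

/-- **Exponential moment of the monochromatic mass** (all non-hub vertices exposed): for `V` symmetric with zero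
diagonal, `0 < q`, `0 ≤ λ` and `2λ·deg(x) ≤ 1` off `H`,
`∑_c exp(λ·(M(univ,c) − M(H,c) − (mass(univ) − mass H)/q)) ≤ q^m · exp(4λ² ∑_{x ∉ H} deg(x)²)`. [new] -/
theorem expMoment_le (V : Fin m → Fin m → ℝ) (hV : ∀ x y, V x y = V y x) (hV0 : ∀ x, V x x = 0)
    (hq : 0 < q) (H : Finset (Fin m)) {lam : ℝ} (hlam : 0 ≤ lam) (hdeg : ∀ x, x ∉ H → 2 * lam * ∑ y, |V x y| ≤ 1) :
    ∑ c : Fin m → Fin q, Real.exp (lam *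
        ((∑ a, ∑ b, if c a = c b then V a b else 0) / 2 -
          (∑ a ∈ H, ∑ b ∈ H, if c a = c b then V a b else 0) / 2 -
          ((∑ a, ∑ b, V a b) / 2 - (∑ a ∈ H, ∑ b ∈ H, V a b) / 2) / q)) ≤
      (q : ℝ) ^ m * Real.exp (4 * lam ^ 2 * ∑ x ∈ Hᶜ, (∑ y, |V x y|) ^ 2) := by
  have h := expMoment_induction V hV hV0 hq H hlam hdeg Hᶜ disjoint_compl_left
  rw [Finset.union_compl] at h
  exact h

/-- **Exponential moment of the monochromatic mass** (registered form of `expMoment_le`). [new] -/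
theorem monoMass_expMoment : ∀ {m q : ℕ} (V : Fin m → Fin m → ℝ), (∀ x y, V x y = V y x) → (∀ x, V x x = 0) → 0 < q → ∀ (H : Finset (Fin m)) (lam : ℝ), 0 ≤ lam → (∀ x, x ∉ H → 2 * lam * ∑ y, |V x y| ≤ 1) → ∑ c : Fin m → Fin q, Real.exp (lam * ((∑ a, ∑ b, if c a = c b then V a b else 0) / 2 - (∑ a ∈ H, ∑ b ∈ H, if c a = c b then V a b else 0) / 2 - ((∑ a, ∑ b, V a b) / 2 - (∑ a ∈ H, ∑ b ∈ H, V a b) / 2) / q)) ≤ (q : ℝ) ^ m * Real.exp (4 * lam ^ 2 * ∑ x ∈ Hᶜ, (∑ y, |V x y|) ^ 2) :=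
  fun V hV hV0 hq H _ hlam hdeg => expMoment_le V hV hV0 hq H hlam hdeg

end

end Summit.PneNP.PneNP.Theorems
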